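import Mathlib
import HarnessLib
import Summits.HubbardSuperconductivity.HubbardSuperconductivity.Theorems.KLProgrammeKLRegimeEngineTowerImportRowsPlain
import Summits.HubbardSuperconductivity.HubbardSuperconductivity.Theorems.KLProgrammeKLRegimeEngineTowerReadoutSixCellPlain

/-!
# Route `KLProgramme` — crux K3 ENGINE (stmt-HubbardSuperconductivity-20437 `KLRegimeEngineV17F2`), stub (b) v2 (ℓ): THE FOUR E1-IMPORT BINDERS OF THE (ℓ) ASSEMBLY
# OF RECORD (`kernelNormsLevels_all_klEng_final`, p696349 l.129–131 and l.150–151) DISCHARGED FROM PLAIN LINES, ALL BLOCKS / LEVELS AT ONCE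
# (cell gate-hubbard-kl, seat hubbard-kl-k3c2-p3 g15, row «sector-counting import»)

`importRowsF_of_plainLines_klEng` (p695324) gives the three import rows of ONE block in the shapes `i₁·(M/β)`, `i₂·(M/β)³`, `x₆·(M/β)⁵`, and `hsix_of_plainLine_klEng`
(p693268) the six-leg level-one cell of ONE level.  The assembly of record quantifies them over the blocks `1 ≤ k` (`2 ≤ k` for the cell), `d·k ≤ n`, at the block's own
coupling `B·epsCoupling P U (d·k)`, and over the levels `1 ≤ j ≤ n`.  This file is the glue: under the stub binders + the five count doors, `2 ≤ d`, `n ≤ nScales β + 1`, a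
frame `K` with `FrameOK R U (nScales β) μ K` (the assembly's `K_n`), plain-line constants `s₂ s₄ s₆` and the plain-line hypotheses quantified exactly like the binders,

* **`importBinders_of_plainLines_klEng`** — `∃ CA > 0` such that … ⊢ the three binder families VERBATIM with `ι₁ := i₁·(M/β)`, `ι₂′ := i₂·(M/β)³`, `X′ := x₆·(M/β)⁵`
  (`i₁ i₂ x₆` the equational closed forms of p695324) — conjunction of three `∀ k` statements;
* **`hsixBinder_of_plainLines_klEng`** — `∃ CA > 0` such that … plain six-leg lines `S₆(j) ≤ s₆·(B·epsCoupling P U j)²` of `𝒱_j[K]` and ONE number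
  `4096·klThinCount6C·CA⁶·s₆·B² ≤ Qe.CE³` ⊢ the `hsix` family VERBATIM (`∀ j, 1 ≤ j → j ≤ n → ∀ Ωe : Fin (2*3) → _, levelCount Ωe = 1 → …`).
Proofs only (quantifier bookkeeping over p695324 / p693268); the plain lines stay hypotheses (E1's producer targets); nothing asserts (ℓ), any stub, K3 or superconductivity.
References: BGM 2006 §2.7 (2.71a), §2.8 (2.76)–(2.80), (2.96)–(2.98), Lemma 2.5 [cite: BenfattoGiulianiMastropietro2006].
-/

noncomputable section

namespace Summit.HubbardSuperconductivity.HubbardSuperconductivity.Theorems.EngineV8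

set_option linter.dupNamespace false -- summit = problem name (single-conjunct summit), D-0017

open Classical
open Real Finset Literature.MathematicalPhysics.QuantumLattice Literature.Probability.LatticeModels GrassmannAlgebra
open Literature.MathematicalPhysics.QuantumLattice.FermiRG
open Summit.HubbardSuperconductivity.HubbardSuperconductivity.Theorems.KLRegimeSplit
open Summit.HubbardSuperconductivity.HubbardSuperconductivity.Theorems.KLProgrammeLegKernels
open Summit.HubbardSuperconductivity.HubbardSuperconductivity.Theorems.DispersionFlow
open Summit.HubbardSuperconductivity.HubbardSuperconductivity.Theorems.KLRegimeWick

/-- **THE THREE IMPORT BINDERS OF `kernelNormsLevels_all_klEng_final` FROM PLAIN LINES** (see the module docstring): `∃ CA > 0` such that, under the stub binders, the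
five count doors, `2 ≤ d`, `n ≤ nScales β + 1`, a frame with `FrameOK R U (nScales β) μ K`, nonnegative `W Z B s₂ s₄ s₆`, and the plain two-, four- and six-leg pinned
`L¹` lines of `𝒱_{dk}[K]` for every block `1 ≤ k`, `d·k ≤ n` bounded by `s₂·4^{−(dk−1)}·(B·ε_{dk})`, `s₄·(B·ε_{dk})`, `s₆·(B·ε_{dk})²`: with
`i₁ = 1458·W·Z·klThinCount2C·CA²·s₂`, `i₂ = 8·W·Z²·(1458·klThinCountC + 531441·klThinCount3C)·CA⁴·s₄`, `x₆ = 3538944·klThinCount6C·CA⁶·s₆`,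
the assembly's binders l.129–131 hold with `ι₁ := i₁·(M/β)`, `ι₂′ := i₂·(M/β)³`, `X′ := x₆·(M/β)⁵`.
[cite: BenfattoGiulianiMastropietro2006, §2.7 (2.71a), §2.8 (2.96)-(2.98), Lemma 2.5] -/
theorem importBinders_of_plainLines_klEng :
    ∃ CA : ℝ, 0 < CA ∧ ∀ (P : SplitConsts) (R : RenConsts) (c : ℝ), P.WF → R.WF2 → 0 < c → c ≤ klEngC₃6 P R →
      c ≤ klThinCountC₃ R → c ≤ klThinCount3C₃ R → c ≤ klThinCount6C₃ R → c ≤ klThinCount2C₃ R →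
      ∀ μ ∈ klWindowC, ∀ U : ℝ, 0 < U → U ≤ klEngU₀9 P R c →
      U ≤ klThinCountU₀ R → U ≤ klThinCount3U₀ R → U ≤ klThinCount6U₀ R → U ≤ klThinCount2U₀ R →
      ∀ β : ℝ, klBetaMin ≤ β → β ≤ Real.exp (c / U ^ 2) →
      ∀ K : TrigPolyC4v, FrameOK R U (nScales β) μ K → ∀ (L M : ℕ) [NeZero L] [NeZero M],
      klEngL₃ β U ≤ L → klEngM₃ β U L ≤ M → ∀ n d : ℕ, n ≤ nScales β + 1 → 2 ≤ d →
      ∀ (W Z B s₂ s₄ s₆ : ℝ), 0 ≤ W → 0 ≤ Z → 0 ≤ B → 0 ≤ s₂ → 0 ≤ s₄ → 0 ≤ s₆ →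
        (∀ k, 1 ≤ k → d * k ≤ n → ∀ (s c' : Fin 2 → Fin 2) (y₀ : SpaceTimeIdx L M),
          fixedTupleL1 L M β 1 (sectorisedKernel L M β (trivialMultiplier L M) (klTowerInput L M β U μ K d k) 2)
            (fun i => (((0 : Fin 1), s i), c' i)) y₀ ≤ s₂ * ((4 : ℝ) ^ (d * k - 1))⁻¹ * (B * epsCoupling P U (d * k))) →
        (∀ k, 1 ≤ k → d * k ≤ n → ∀ (s c' : Fin 4 → Fin 2) (y₀ : SpaceTimeIdx L M),
          fixedTupleL1 L M β 3 (sectorisedKernel L M β (trivialMultiplier L M) (klTowerInput L M β U μ K d k) 4)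
            (fun i => (((0 : Fin 1), s i), c' i)) y₀ ≤ s₄ * (B * epsCoupling P U (d * k))) →
        (∀ k, 1 ≤ k → d * k ≤ n → ∀ (s c' : Fin 6 → Fin 2) (y₀ : SpaceTimeIdx L M),
          fixedTupleL1 L M β 5 (sectorisedKernel L M β (trivialMultiplier L M) (klTowerInput L M β U μ K d k) 6)
            (fun i => (((0 : Fin 1), s i), c' i)) y₀ ≤ s₆ * (B * epsCoupling P U (d * k)) ^ 2) →
      ∀ (i₁ i₂ x₆ : ℝ), i₁ = 1458 * W * Z * klThinCount2C * CA ^ 2 * s₂ →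
        i₂ = 8 * W * Z ^ 2 * (1458 * klThinCountC + 531441 * klThinCount3C) * CA ^ 4 * s₄ →
        x₆ = 3538944 * klThinCount6C * CA ^ 6 * s₆ →
      (∀ k, 1 ≤ k → d * k ≤ n → W * Z ^ 1 * klTowerMuLevF L M β U μ K d k 1 ≤ (i₁ * ((M : ℝ) / β)) * (B * epsCoupling P U (d * k))) ∧
      (∀ k, 1 ≤ k → d * k ≤ n → W * Z ^ 2 * klTowerMuLevF L M β U μ K d k 2 ≤ (i₂ * ((M : ℝ) / β) ^ 3) * (B * epsCoupling P U (d * k))) ∧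
      (∀ k, 2 ≤ k → d * k ≤ n → klTowerMuLevAtF L M β U μ K d 0 k 3 ≤ (x₆ * ((M : ℝ) / β) ^ 5) * (B * epsCoupling P U (d * k)) ^ 2) := by
  obtain ⟨CA, hCA, h⟩ := importRowsF_of_plainLines_klEng
  refine ⟨CA, hCA, ?_⟩
  intro P R c hP hR2 hc hc6 hcT hcT3 hcT6 hcT2 μ hμ U hU hU9 hUT hUT3 hUT6 hUT2 β hβmin hβc K hK L M _ _ hL3 hM3 n d hnN hd
    W Z B s₂ s₄ s₆ hW hZ hB hs₂ hs₄ hs₆ hS₂ hS₄ hS₆ i₁ i₂ x₆ hi₁ hi₂ hx₆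
  have hK0 : 0 ≤ P.Klam := zero_le_one.trans hP.1
  have hrow : ∀ k, 1 ≤ k → d * k ≤ n →
      W * Z ^ 1 * klTowerMuLevF L M β U μ K d k 1 ≤ (i₁ * ((M : ℝ) / β)) * (B * epsCoupling P U (d * k)) ∧
      W * Z ^ 2 * klTowerMuLevF L M β U μ K d k 2 ≤ (i₂ * ((M : ℝ) / β) ^ 3) * (B * epsCoupling P U (d * k)) ∧
      klTowerMuLevAtF L M β U μ K d 0 k 3 ≤ (x₆ * ((M : ℝ) / β) ^ 5) * (B * epsCoupling P U (d * k)) ^ 2 := by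
    intro k hk hkn
    have hdk : 2 ≤ d * k := le_trans hd (Nat.le_mul_of_pos_right d hk)
    have hlam : 0 ≤ B * epsCoupling P U (d * k) := mul_nonneg hB (epsCoupling_nonneg' hK0 U (d * k))
    exact h P R c hP hR2 hc hc6 hcT hcT3 hcT6 hcT2 μ hμ U hU hU9 hUT hUT3 hUT6 hUT2 β hβmin hβc K hK L M hL3 hM3 d k (by omega) (by omega)
      W Z (B * epsCoupling P U (d * k)) s₂ s₄ s₆ hW hZ hlam hs₂ hs₄ hs₆ (hS₂ k hk hkn) (hS₄ k hk hkn) (hS₆ k hk hkn) i₁ i₂ x₆ hi₁ hi₂ hx₆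
  exact ⟨fun k hk hkn => (hrow k hk hkn).1, fun k hk hkn => (hrow k hk hkn).2.1, fun k hk hkn => (hrow k (by omega) hkn).2.2⟩

/-- **THE `hsix` BINDER OF `kernelNormsLevels_all_klEng_final` FROM PLAIN LINES** (l.150–151 of the assembly): `∃ CA > 0` such that, under the stub binders, the six-count
doors, `n ≤ nScales β + 1`, a frame with `FrameOK R U (nScales β) μ K`, nonnegative `B s₆`, the plain six-leg pinned `L¹` lines of `𝒱_j[K]` at every level `1 ≤ j ≤ n`
bounded by `s₆·(B·ε_j)²`, and ONE number `4096·klThinCount6C·CA⁶·s₆·B² ≤ Qe.CE³`: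
`∀ j, 1 ≤ j → j ≤ n → ∀ Ωe : Fin (2*3) → _, levelCount Ωe = 1 → klAnisoLegKernelNormAt L M β U μ K klE0 j (2*3) Ωe ≤ Qe.CE³·(epsCoupling P U j)²·2^{(4:ℤ)·j}`.
[cite: BenfattoGiulianiMastropietro2006, §2.8 (2.96)-(2.98), Lemma 2.5] -/
theorem hsixBinder_of_plainLines_klEng :
    ∃ CA : ℝ, 0 < CA ∧ ∀ (P : SplitConsts) (R : RenConsts) (c : ℝ), P.WF → R.WF2 → 0 < c → c ≤ klEngC₃6 P R → c ≤ klThinCount6C₃ R →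
      ∀ μ ∈ klWindowC, ∀ U : ℝ, 0 < U → U ≤ klEngU₀9 P R c → U ≤ klThinCount6U₀ R → ∀ β : ℝ, klBetaMin ≤ β → β ≤ Real.exp (c / U ^ 2) →
      ∀ K : TrigPolyC4v, FrameOK R U (nScales β) μ K → ∀ (L M : ℕ) [NeZero L] [NeZero M],
      klEngL₃ β U ≤ L → klEngM₃ β U L ≤ M → ∀ n : ℕ, n ≤ nScales β + 1 →
      ∀ (B s₆ : ℝ), 0 ≤ B → 0 ≤ s₆ →
        (∀ j, 1 ≤ j → j ≤ n → ∀ (s c' : Fin 6 → Fin 2) (y₀ : SpaceTimeIdx L M),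
          fixedTupleL1 L M β 5 (sectorisedKernel L M β (trivialMultiplier L M) (klEffectiveAction L M β U μ K klE0 j) 6)
            (fun i => (((0 : Fin 1), s i), c' i)) y₀ ≤ s₆ * (B * epsCoupling P U j) ^ 2) →
      ∀ Qe : EngConsts, 4096 * klThinCount6C * CA ^ 6 * s₆ * B ^ 2 ≤ Qe.CE ^ 3 →
      ∀ j : ℕ, 1 ≤ j → j ≤ n → ∀ Ωe : Fin (2 * 3) → Option (SectorLeg (sectorCount j)), levelCount Ωe = 1 →
        klAnisoLegKernelNormAt L M β U μ K klE0 j (2 * 3) Ωe ≤ Qe.CE ^ 3 * (epsCoupling P U j) ^ 2 * (2 : ℝ) ^ ((4 : ℤ) * j) := by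
  obtain ⟨CA, hCA, h⟩ := hsix_of_plainLine_klEng
  refine ⟨CA, hCA, ?_⟩
  intro P R c hP hR2 hc hc6 hcT6 μ hμ U hU hU9 hUT6 β hβmin hβc K hK L M _ _ hL3 hM3 n hnN B s₆ hB hs₆ hS₆ Qe hCE j hj hjn Ωe hΩe
  have hK0 : 0 ≤ P.Klam := zero_le_one.trans hP.1
  have hε : 0 ≤ epsCoupling P U j := epsCoupling_nonneg' hK0 U j
  have hS0 : 0 ≤ s₆ * (B * epsCoupling P U j) ^ 2 := by positivity
  have hside : 4096 * klThinCount6C * (CA ^ 6 * (s₆ * (B * epsCoupling P U j) ^ 2)) ≤ Qe.CE ^ 3 * (epsCoupling P U j) ^ 2 := by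
    have h2 : (0 : ℝ) ≤ (epsCoupling P U j) ^ 2 := by positivity
    calc 4096 * klThinCount6C * (CA ^ 6 * (s₆ * (B * epsCoupling P U j) ^ 2))
        = (4096 * klThinCount6C * CA ^ 6 * s₆ * B ^ 2) * (epsCoupling P U j) ^ 2 := by ring
      _ ≤ Qe.CE ^ 3 * (epsCoupling P U j) ^ 2 := mul_le_mul_of_nonneg_right hCE h2
  exact h P R c hP hR2 hc hc6 hcT6 μ hμ U hU hU9 hUT6 β hβmin hβc K hK L M hL3 hM3 j hj (by omega) _ hS0 (hS₆ j hj hjn) Qe hside Ωe hΩe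

end Summit.HubbardSuperconductivity.HubbardSuperconductivity.Theorems.EngineV8

end
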